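import Summits.PneNP.PneNP.Theorems.SymmetryBudgetNoHiddenOrderProgramSrcsA
import Summits.PneNP.PneNP.Theorems.SymmetryBudgetNoHiddenOrderProgramGatesSym

/-!
# `NoHiddenOrder` (stmt-PneNP-14781), (R2c) VI: the window canoniser program — source equivariance of the small shapes

Route `PneNP/SymmetryBudget`; companion of `…ProgramSrcsA.lean` (seat -1) and `…ProgramGatesSym.lean`.  The `srcs_eq` half of
`SymProg.IsSym` for the assembled program is, shape by shape, the statement that the image of a source set under the wire map
`F = Sum.map (diagMap ρ) (θ ρ)` is the source set of the relabelled shape.  This file proves it for the shapes of `…ProgramSrcsA.lean`,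
PARAMETRIC in the wire map `F`, the embeddings `e, e'` of the shape into the gate type and the input wires — so that the dispatch only has
to supply `F (inr (e g)) = inr (e' (g.relabel σ))` (by `rfl` for `Gt.perm`) and the input-wire equations:
`ccSrcs_image`, `ctSrcs_image`, `riLtW_image`, `riEqW_image`, `riSrcs_image`, `vsSrcs_image`, `voSrcs_image`, `vaSrcs_image`; the kinds
are invariant (`riKind_relabel`, `vsKind_relabel`, `voKind_relabel`, `vaKind_relabel`); and the root data are equivariant under
`Gt.perm ρ (budgetPerm ρ hρ)`: `FLab.relabel_rootLab`, `map_adjWire`, `map_sigW` (a budget permutation fixes the ordered coordinates),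
`map_rootIn_mem/adj/lt0/eq0`.  Sorry-free; supports stmt-PneNP-14781, does not close it.
-/

set_option linter.dupNamespace false -- `Summit.PneNP.PneNP.…` (D-0017 single-conjunct layout)

namespace Summit.PneNP.PneNP.Theorems

open Finset CGBits BranchSum Literature.Computability.Complexity Literature.Computability.Complexity.SymProg

namespace WCanon

variable {m : ℕ}

/-! ### Reindexing images over the window type -/

/-- Reindexing an image over a finite type along a permutation. [folklore] -/
theorem image_univ_comp_equiv {α β : Type*} [Fintype α] [DecidableEq β] (σ : Equiv.Perm α) (f : α → β) :
    (univ.image fun a => f (σ a)) = univ.image f := by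
  ext b
  simp only [mem_image, mem_univ, true_and]
  exact ⟨fun ⟨a, h⟩ => ⟨σ a, h⟩, fun ⟨a, h⟩ => ⟨σ.symm a, by simpa using h⟩⟩

/-- The image of an image over a finite type, reindexed along a permutation. [folklore] -/
theorem image_image_univ_equiv {α β γ : Type*} [Fintype α] [DecidableEq β] [DecidableEq γ] (σ : Equiv.Perm α) (f : α → β)
    (F : β → γ) (f' : α → γ) (h : ∀ a, F (f a) = f' (σ a)) : (univ.image f).image F = univ.image f' := by
  rw [Finset.image_image, ← image_univ_comp_equiv σ f']
  exact congrArg (fun g : α → γ => univ.image g) (funext fun a => h a : F ∘ f = fun a => f' (σ a))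

/-- The image of an image over a filtered finite type (the index fixed). [folklore] -/
theorem image_image_congr {α β γ : Type*} [DecidableEq β] [DecidableEq γ] (s : Finset α) (f : α → β) (F : β → γ) (f' : α → γ)
    (h : ∀ a, F (f a) = f' a) : (s.image f).image F = s.image f' := by
  rw [Finset.image_image]
  exact congrArg (fun g : α → γ => s.image g) (funext fun a => h a : F ∘ f = f')

/-! ### `CmpCount` and `CmpTwice` -/

/-- **Source equivariance of a `CmpCount` shape.** [folklore] -/
theorem ccSrcs_image (F : Wire m → Wire m) (A B : Finset (Wire m)) (e e' : CCGate m → Gt m)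
    (he : ∀ g, F (Sum.inr (e g)) = Sum.inr (e' g)) (g : CCGate m) :
    (ccSrcs A B e g).image F = ccSrcs (A.image F) (B.image F) e' g := by
  cases g <;> simp [ccSrcs, Finset.image_insert, Finset.image_singleton, he, Finset.image_image, Function.comp_def]

/-- **Source equivariance of a `CmpTwice` shape.** [folklore] -/
theorem ctSrcs_image (F : Wire m → Wire m) (A B : Finset (Wire m)) (e e' : CTGate m → Gt m)
    (he : ∀ g, F (Sum.inr (e g)) = Sum.inr (e' g)) (g : CTGate m) :
    (ctSrcs A B e g).image F = ctSrcs (A.image F) (B.image F) e' g := by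
  cases g <;> simp [ctSrcs, Finset.image_insert, Finset.image_singleton, he, Finset.image_image, Function.comp_def]

/-! ### `RefineIter` with value read-out -/

section RI

variable (F : Wire m → Wire m) (σ : Equiv.Perm (WV m)) (ι ι' : RIIn m) (e e' : RIGate m → Gt m)
  (he : ∀ g, F (Sum.inr (e g)) = Sum.inr (e' (g.relabel σ)))
  (hmem : ∀ y, F (ι.mem y) = ι'.mem (σ y)) (hadj : ∀ u y, F (ι.adj u y) = ι'.adj (σ u) (σ y))
  (hlt0 : ∀ u v, F (ι.lt0 u v) = ι'.lt0 (σ u) (σ v)) (heq0 : ∀ u v, F (ι.eq0 u v) = ι'.eq0 (σ u) (σ v))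
include he

/-- Equivariance of the order wire entering a round. [folklore] -/
theorem riLtW_image (hlt0 : ∀ u v, F (ι.lt0 u v) = ι'.lt0 (σ u) (σ v)) (r : Fin (wn m + 1)) (u v : WV m) :
    F (riLtW ι e r u v) = riLtW ι' e' r (σ u) (σ v) := by
  unfold riLtW
  split_ifs with h
  · exact hlt0 u v
  · rw [he]; rfl

/-- Equivariance of the kernel wire entering a round. [folklore] -/
theorem riEqW_image (heq0 : ∀ u v, F (ι.eq0 u v) = ι'.eq0 (σ u) (σ v)) (r : Fin (wn m + 1)) (u v : WV m) :
    F (riEqW ι e r u v) = riEqW ι' e' r (σ u) (σ v) := by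
  unfold riEqW
  split_ifs with h
  · exact heq0 u v
  · rw [he]; rfl

/-- The inlined kernel wire of round `r < T`. [folklore] -/
theorem inl_eqW_image (heq0 : ∀ u v, F (ι.eq0 u v) = ι'.eq0 (σ u) (σ v)) (r : Fin (wn m)) (u v : WV m) :
    F (if _h : (r : ℕ) = 0 then ι.eq0 u v else Sum.inr (e (.eqS ⟨r - 1, by omega⟩ u v))) =
      (if _h : (r : ℕ) = 0 then ι'.eq0 (σ u) (σ v) else Sum.inr (e' (.eqS ⟨r - 1, by omega⟩ (σ u) (σ v)))) := by
  split_ifs with h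
  · exact heq0 u v
  · rw [he]; rfl

/-- The inlined order wire of round `r < T`. [folklore] -/
theorem inl_ltW_image (hlt0 : ∀ u v, F (ι.lt0 u v) = ι'.lt0 (σ u) (σ v)) (r : Fin (wn m)) (u v : WV m) :
    F (if _h : (r : ℕ) = 0 then ι.lt0 u v else Sum.inr (e (.ltS ⟨r - 1, by omega⟩ u v))) =
      (if _h : (r : ℕ) = 0 then ι'.lt0 (σ u) (σ v) else Sum.inr (e' (.ltS ⟨r - 1, by omega⟩ (σ u) (σ v)))) := by
  split_ifs with h
  · exact hlt0 u v
  · rw [he]; rfl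

include hmem hadj hlt0 heq0 in
/-- **Source equivariance of a refinement shape with value read-out.** [folklore] -/
theorem riSrcs_image (g : RIGate m) : (riSrcs ι e g).image F = riSrcs ι' e' (g.relabel σ) := by
  cases g with
  | c r u w y =>
    simp only [riSrcs, RIGate.relabel, image_insert, image_singleton, hmem, hadj]
    rw [inl_eqW_image F σ ι ι' e e' he heq0]
  | cmp r u v w g =>
    simp only [riSrcs, RIGate.relabel]
    rw [ccSrcs_image F _ _ (fun g' => e (.cmp r u v w g')) (fun g' => e' (.cmp r (σ u) (σ v) (σ w) g')) (fun g' => he _)]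
    rw [image_image_univ_equiv σ _ F (fun y => Sum.inr (e' (.c r (σ u) (σ w) y))) (fun y => he _),
      image_image_univ_equiv σ _ F (fun y => Sum.inr (e' (.c r (σ v) (σ w) y))) (fun y => he _)]
  | nmem w => simp only [riSrcs, RIGate.relabel, image_singleton, hmem]
  | nlt r w' w =>
    simp only [riSrcs, RIGate.relabel, image_singleton]
    rw [inl_ltW_image F σ ι ι' e e' he hlt0]
  | pre r u v w w' => simp only [riSrcs, RIGate.relabel, image_insert, image_singleton, he]
  | allpre r u v w =>
    simp only [riSrcs, RIGate.relabel]
    exact image_image_univ_equiv σ _ F _ (fun y => he _)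
  | wit r u v w => simp only [riSrcs, RIGate.relabel, image_insert, image_singleton, he, hmem]
  | prof r u v =>
    simp only [riSrcs, RIGate.relabel]
    exact image_image_univ_equiv σ _ F _ (fun y => he _)
  | tie r u v =>
    simp only [riSrcs, RIGate.relabel, image_insert, image_singleton, he]
    rw [inl_eqW_image F σ ι ι' e e' he heq0]
  | ltS r u v =>
    simp only [riSrcs, RIGate.relabel, image_insert, image_singleton, he]
    rw [inl_ltW_image F σ ι ι' e e' he hlt0]
  | eqS r u v => simp only [riSrcs, RIGate.relabel, image_insert, image_singleton, he]
  | vc w v =>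
    simp only [riSrcs, RIGate.relabel, image_insert, image_singleton, hmem]
    rw [riLtW_image F σ ι ι' e e' he hlt0]
  | vge v t =>
    simp only [riSrcs, RIGate.relabel]
    exact image_image_univ_equiv σ _ F _ (fun y => he _)
  | vnge v t => simp only [riSrcs, RIGate.relabel, image_singleton, he]
  | vinA v t => simp only [riSrcs, RIGate.relabel, image_insert, image_singleton, he, hmem]
  | vnm v => simp only [riSrcs, RIGate.relabel, image_singleton, hmem]
  | vval v t =>
    simp only [riSrcs, RIGate.relabel]
    split_ifs <;> simp only [image_insert, image_singleton, he] <;> rfl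

end RI

/-- The kind of a refinement shape is invariant. [folklore] -/
theorem riKind_relabel (σ : Equiv.Perm (WV m)) (g : RIGate m) : riKind (g.relabel σ) = riKind g := by
  cases g <;> rfl

/-! ### The three `VecCmp` shapes -/

/-- **Source equivariance of the signature comparison shape** (owners relabelled, coordinates fixed). [folklore] -/
theorem vsSrcs_image (F : Wire m → Wire m) (σ : Equiv.Perm (WV m)) (b b' : WV m → Fin (m + m) → Wire m) (e e' : VSGate m → Gt m)
    (he : ∀ g, F (Sum.inr (e g)) = Sum.inr (e' (g.relabel σ))) (hb : ∀ k j, F (b k j) = b' (σ k) j) (g : VSGate m) :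
    (vsSrcs b e g).image F = vsSrcs b' e' (g.relabel σ) := by
  cases g with
  | both k k' j => simp only [vsSrcs, VSGate.relabel, image_insert, image_singleton, hb]
  | none k k' j => simp only [vsSrcs, VSGate.relabel, image_insert, image_singleton, hb]
  | eqv k k' j => simp only [vsSrcs, VSGate.relabel, image_insert, image_singleton, he]
  | nb k j => simp only [vsSrcs, VSGate.relabel, image_singleton, hb]
  | lt k k' j =>
    simp only [vsSrcs, VSGate.relabel, image_union, image_insert, image_singleton, he, hb]
    rw [image_image_congr _ _ F (fun q => Sum.inr (e' (.eqv (σ k) (σ k') q))) (fun q => he _)]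
  | less k k' => simp only [vsSrcs, VSGate.relabel]; exact image_image_congr _ _ F _ (fun j => he _)
  | eqall k k' => simp only [vsSrcs, VSGate.relabel]; exact image_image_congr _ _ F _ (fun j => he _)

/-- The kind of the signature comparison shape is invariant. [folklore] -/
theorem vsKind_relabel (σ : Equiv.Perm (WV m)) (g : VSGate m) : vsKind (g.relabel σ) = vsKind g := by
  cases g <;> rfl

/-- **Source equivariance of the candidates' comparison shape.** [folklore] -/
theorem voSrcs_image (F : Wire m → Wire m) (σ : Equiv.Perm (WV m)) (b b' : WV m × Fin (wn m) → Fin (NB (wn m)) → Wire m)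
    (e e' : VOGate m → Gt m) (he : ∀ g, F (Sum.inr (e g)) = Sum.inr (e' (g.relabel σ)))
    (hb : ∀ k j, F (b k j) = b' (cκ σ k) j) (g : VOGate m) :
    (voSrcs b e g).image F = voSrcs b' e' (g.relabel σ) := by
  cases g with
  | both k k' j => simp only [voSrcs, VOGate.relabel, image_insert, image_singleton, hb]
  | none k k' j => simp only [voSrcs, VOGate.relabel, image_insert, image_singleton, hb]
  | eqv k k' j => simp only [voSrcs, VOGate.relabel, image_insert, image_singleton, he]
  | nb k j => simp only [voSrcs, VOGate.relabel, image_singleton, hb]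
  | lt k k' j =>
    simp only [voSrcs, VOGate.relabel, image_union, image_insert, image_singleton, he, hb]
    rw [image_image_congr _ _ F (fun q => Sum.inr (e' (.eqv (cκ σ k) (cκ σ k') q))) (fun q => he _)]
  | less k k' => simp only [voSrcs, VOGate.relabel]; exact image_image_congr _ _ F _ (fun j => he _)
  | eqall k k' => simp only [voSrcs, VOGate.relabel]; exact image_image_congr _ _ F _ (fun j => he _)

/-- The kind of the candidates' comparison shape is invariant. [folklore] -/
theorem voKind_relabel (σ : Equiv.Perm (WV m)) (g : VOGate m) : voKind (g.relabel σ) = voKind g := by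
  cases g <;> rfl

/-- **Source equivariance of the parts' comparison shape.** [folklore] -/
theorem vaSrcs_image (F : Wire m → Wire m) (σ : Equiv.Perm (WV m)) (b b' : Finset (WV m) → Fin (NB (wn m)) → Wire m)
    (e e' : VAGate m → Gt m) (he : ∀ g, F (Sum.inr (e g)) = Sum.inr (e' (g.relabel σ)))
    (hb : ∀ k j, F (b k j) = b' (fs σ k) j) (g : VAGate m) :
    (vaSrcs b e g).image F = vaSrcs b' e' (g.relabel σ) := by
  cases g with
  | both k k' j => simp only [vaSrcs, VAGate.relabel, image_insert, image_singleton, hb]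
  | none k k' j => simp only [vaSrcs, VAGate.relabel, image_insert, image_singleton, hb]
  | eqv k k' j => simp only [vaSrcs, VAGate.relabel, image_insert, image_singleton, he]
  | nb k j => simp only [vaSrcs, VAGate.relabel, image_singleton, hb]
  | lt k k' j =>
    simp only [vaSrcs, VAGate.relabel, image_union, image_insert, image_singleton, he, hb]
    rw [image_image_congr _ _ F (fun q => Sum.inr (e' (.eqv (fs σ k) (fs σ k') q))) (fun q => he _)]
  | less k k' => simp only [vaSrcs, VAGate.relabel]; exact image_image_congr _ _ F _ (fun j => he _)
  | eqall k k' => simp only [vaSrcs, VAGate.relabel]; exact image_image_congr _ _ F _ (fun j => he _)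

/-- The kind of the parts' comparison shape is invariant. [folklore] -/
theorem vaKind_relabel (σ : Equiv.Perm (WV m)) (g : VAGate m) : vaKind (g.relabel σ) = vaKind g := by
  cases g <;> rfl

/-! ### Root data under a budget permutation -/

section Root

variable {ρ : Equiv.Perm (Fin m)} (hρ : ρ ∈ pointStabiliserBudget m (Nat.log 2 m))

/-- The wire map of the program over `ρ ∈ Bud`: the diagonal input map and `Gt.perm ρ (budgetPerm ρ hρ)`. [folklore] -/
abbrev Fw (hρ : ρ ∈ pointStabiliserBudget m (Nat.log 2 m)) : Wire m → Wire m := Sum.map (diagMap ρ) (Gt.perm ρ (budgetPerm ρ hρ))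

/-- A budget permutation fixes the ordered positions. [folklore] -/
theorem apply_eq_self_of_not_mem_windowSet (hρ : ρ ∈ pointStabiliserBudget m (Nat.log 2 m)) {i : Fin m}
    (hi : i ∉ Summit.PneNP.PneNP.Theorems.windowSet m) : ρ i = i := by
  rw [mem_windowSet_iff, not_not] at hi
  exact hρ i hi

/-- **The root label is fixed** by every relabelling. [folklore] -/
theorem FLab.relabel_rootLab (σ : Equiv.Perm (WV m)) (h : 0 < wn m) : FLab.relabel σ (rootLab m h) = rootLab m h := by
  refine Subtype.ext ?_
  simp only [FLab.coe_relabel, FLab.relabelRaw, rootLab, Finset.map_univ_equiv, Finset.map_empty, Prod.mk.injEq, true_and]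
  rfl

/-- The symmetrised window adjacency wire is equivariant. [folklore] -/
theorem map_adjWire (u v : WV m) : Fw hρ (adjWire u v) = adjWire (budgetPerm ρ hρ u) (budgetPerm ρ hρ v) := rfl

/-- **The signature wires are equivariant** (the ordered coordinates are fixed by `ρ`, the window coordinates read the constant). [folklore] -/
theorem map_sigW (u : WV m) (j : Fin (m + m)) : Fw hρ (sigW u j) = sigW (budgetPerm ρ hρ u) j := by
  unfold sigW sigWire
  by_cases hj : (j : ℕ) < m
  · rw [dif_pos hj, dif_pos hj]
    by_cases hw : (⟨j, hj⟩ : Fin m) ∈ Summit.PneNP.PneNP.Theorems.windowSet m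
    · rw [if_pos hw, if_pos hw]; rfl
    · rw [if_neg hw, if_neg hw]
      show Sum.inl (ρ u.1, ρ ⟨j, hj⟩) = _
      rw [apply_eq_self_of_not_mem_windowSet hρ hw]; rfl
  · rw [dif_neg hj, dif_neg hj]
    by_cases hw : (⟨(j : ℕ) - m, by omega⟩ : Fin m) ∈ Summit.PneNP.PneNP.Theorems.windowSet m
    · rw [if_pos hw, if_pos hw]; rfl
    · rw [if_neg hw, if_neg hw]
      show Sum.inl (ρ ⟨(j : ℕ) - m, _⟩, ρ u.1) = _
      rw [apply_eq_self_of_not_mem_windowSet hρ hw]; rfl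

/-- The membership input of the root refinement is fixed. [folklore] -/
theorem map_rootIn_mem (y : WV m) : Fw hρ ((rootIn m).mem y) = (rootIn m).mem (budgetPerm ρ hρ y) := rfl

/-- The adjacency input of the root refinement is equivariant. [folklore] -/
theorem map_rootIn_adj (u y : WV m) : Fw hρ ((rootIn m).adj u y) = (rootIn m).adj (budgetPerm ρ hρ u) (budgetPerm ρ hρ y) := rfl

/-- The initial order input of the root refinement is equivariant. [folklore] -/
theorem map_rootIn_lt0 (u v : WV m) : Fw hρ ((rootIn m).lt0 u v) = (rootIn m).lt0 (budgetPerm ρ hρ u) (budgetPerm ρ hρ v) := rfl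

/-- The initial kernel input of the root refinement is equivariant. [folklore] -/
theorem map_rootIn_eq0 (u v : WV m) : Fw hρ ((rootIn m).eq0 u v) = (rootIn m).eq0 (budgetPerm ρ hρ u) (budgetPerm ρ hρ v) := rfl

/-- **Source equivariance of the root refinement** `root g` (sources `riSrcs (rootIn m) .root`). [folklore] -/
theorem riSrcs_rootIn_image (g : RIGate m) :
    (riSrcs (rootIn m) Gt.root g).image (Fw hρ) = riSrcs (rootIn m) Gt.root (g.relabel (budgetPerm ρ hρ)) :=
  riSrcs_image (Fw hρ) (budgetPerm ρ hρ) (rootIn m) (rootIn m) Gt.root Gt.root (fun _ => rfl) (fun _ => rfl) (fun _ _ => rfl)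
    (fun _ _ => rfl) (fun _ _ => rfl) g

/-- **Source equivariance of the signature comparison** `sig g` (sources `vsSrcs sigW .sig`). [folklore] -/
theorem vsSrcs_sigW_image (g : VSGate m) :
    (vsSrcs sigW Gt.sig g).image (Fw hρ) = vsSrcs sigW Gt.sig (g.relabel (budgetPerm ρ hρ)) :=
  vsSrcs_image (Fw hρ) (budgetPerm ρ hρ) sigW sigW Gt.sig Gt.sig (fun _ => rfl) (map_sigW hρ) g

end Root

end WCanon

end Summit.PneNP.PneNP.Theorems
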